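import Mathlib
import HarnessLib
import Summits.QuantumFields.YangMills.Theorems.LangevinControlUVFemtoCurvatureTwoPointAxisProfileAntitone
import Summits.QuantumFields.YangMills.Theorems.LangevinControlUVFemtoCurvatureTwoPointPlaqReflectCauchySchwarz

/-!
# Route `LangevinControlUV`, crux `FemtoCurvatureTwoPointC` (stmt-QuantumFields-16204), line `Sketch`, reshape v6 —
# the LONGITUDINAL plaquette-covariance profile is non-negative and symmetric (reflection positivity)

Registered stub `stub_longCovNonnegSymm` of skeleton v6 (`Cruxes/FemtoCurvatureTwoPointC/Lines/Sketch.lean`), landed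
`--supports stmt-QuantumFields-16204`. For every compact `G`, continuous `ρ`, torus `(ℤ/L)⁴` and `β ≥ 0`, the longitudinal profile `g(s) = Cov_{L,β}(P_0^{01}, P_{s e₀}^{01})` (`P = N − Re tr ρ(U_p)`) satisfies `g ≥ 0` and `g(L − s) = g(s)`.

Mechanism (the longitudinal analogue of the tree's TRANSVERSE `AxisCovNonneg.timeAxisCov_nonneg`, crux
stmt-QuantumFields-9363): here the plaquette plane `(0,1)` CONTAINS the reflection (time) direction `0`, so
the plaquettes are TEMPORAL and no coordinate permutation is needed. The three reflections of the tree
(link `θ t = 1 − t` on even `L` at `β ≥ 0`, site `θ' t = −t` on even `L`, odd-torus `θ` on odd `L ≥ 3` at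
`β ≥ 0`) preserve the Wilson state and are positive on the centred plaquette function of ANY positive
plaquette (tree `RPCauchySchwarz.covariance_rp_cauchySchwarz` with the `DependsOn` positivity lemmas of
`…PlaqReflectCauchySchwarz`), whence `Cov(P_{ϑp}, P_p) ≥ 0`; the mirror `ϑp` of the temporal plaquette
based at time `a` is the temporal plaquette based at `−a` (link / odd-torus, separation `2a`) or at
`−(a + 1)` (site, separation `2a + 1`) — `Re tr` being blind to the reversed orientation
(tree `WilsonRP.plaqRe_timeReflect`, `WilsonSiteRP.plaqRe_negReflect`). Cases: `s ≡ 0 (mod L)` is a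
variance; even `L`: link mirror (even `s`) / site mirror (odd `s`); odd `L`: odd-torus mirror at
separation `s` (even `s`) or `L − s` (odd `s`, then swap); translation invariance moves every pair to the
origin. Symmetry `g(L − s) = g(s)`: `(L − s) e₀ = −s e₀` and `Cov(P_0, P_{−x}) = Cov(P_0, P_x)`
(tree `AxisCovNonneg.cov_origin_neg`).
-/

set_option autoImplicit false

noncomputable section

open MeasureTheory
open Literature.MathematicalPhysics.QuantumFieldTheory

namespace Summit.QuantumFields.YangMills.Theorems.FemtoCurvatureTwoPoint.AxisCovNonneg

/-! ## Temporal plaquettes on the time axis and their three mirrors -/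

section TemporalMirror

/-- On the time axis, `(c e₀) + e₀ = (c + 1) e₀`. [folklore] -/
private theorem shift_single_zero {d L : ℕ} [NeZero d] (c : ZMod L) :
    Site.shift (Pi.single (0 : Fin d) c : Site d L) 0 = (Pi.single (0 : Fin d) (c + 1) : Site d L) := by
  simp only [Site.shift, Pi.single_add]

/-- The link (or odd-torus) plaquette reflection `ϑ` maps the TEMPORAL plaquette based at `c e₀` in a
plane containing the time direction to the temporal plaquette based at `(−c) e₀`. [folklore] -/
private theorem plaqReflect_single_of_eq_zero {d L : ℕ} [NeZero d] (c : ZMod L)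
    (q : {p : Fin d × Fin d // p.1 < p.2}) (hq : q.1.1 = 0) :
    WilsonRP.plaqReflect (((Pi.single (0 : Fin d) c : Site d L), q) : Plaquette d L) =
      ((Pi.single (0 : Fin d) (-c) : Site d L), q) := by
  simp only [WilsonRP.plaqReflect, hq, ↓reduceIte, shift_single_zero, timeReflect_single]
  congr 2
  ring

/-- The site plaquette reflection `ϑ'` maps the TEMPORAL plaquette based at `c e₀` in a plane
containing the time direction to the temporal plaquette based at `(−(c + 1)) e₀`. [folklore] -/
private theorem sitePlaqReflect_single_of_eq_zero {d L : ℕ} [NeZero d] (c : ZMod L)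
    (q : {p : Fin d × Fin d // p.1 < p.2}) (hq : q.1.1 = 0) :
    WilsonSiteRP.sitePlaqReflect (((Pi.single (0 : Fin d) c : Site d L), q) : Plaquette d L) =
      ((Pi.single (0 : Fin d) (-(c + 1)) : Site d L), q) := by
  simp only [WilsonSiteRP.sitePlaqReflect, hq, ↓reduceIte, shift_single_zero, negReflect_single]

variable {d L N : ℕ} [NeZero d] [NeZero L] {G : Type*} [Group G] [TopologicalSpace G]
  [IsTopologicalGroup G] [CompactSpace G] [MeasurableSpace G] [BorelSpace G]
  (ρ : G →* Matrix (Fin N) (Fin N) ℂ)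

/-- **General link-mirror pairs** (`L` even, `β ≥ 0`): for ANY positive plaquette `p` (spatial or
temporal), `Cov(P_{ϑp}, P_p) ≥ 0` with `ϑ = WilsonRP.plaqReflect` — the diagonal clause of the tree's
`RPCauchySchwarz.covariance_rp_cauchySchwarz` for the link reflection. [folklore] -/
private theorem cov_plaqReflect_nonneg_even (hL : Even L) (hρ : Continuous ρ) {β : ℝ} (hβ : 0 ≤ β)
    {p : Plaquette d L} (hp : WilsonRP.IsPosPlaq p) :
    0 ≤ wilsonExpectation ρ β (fun U : GaugeConfig d L G =>
          WilsonRP.plaqRe ρ U (WilsonRP.plaqReflect p) * WilsonRP.plaqRe ρ U p)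
        - wilsonExpectation ρ β (fun U : GaugeConfig d L G =>
            WilsonRP.plaqRe ρ U (WilsonRP.plaqReflect p))
          * wilsonExpectation ρ β (fun U : GaugeConfig d L G => WilsonRP.plaqRe ρ U p) := by
  haveI := isProbabilityMeasure_wilsonMeasure (d := d) (L := L) ρ hρ β
  haveI : Fact (1 < L) := ⟨by obtain ⟨r, hr⟩ := hL; have := NeZero.ne L; omega⟩
  have key := FiniteSusceptibilityWeakCoupling.RPCauchySchwarz.covariance_rp_cauchySchwarz
    (μ := wilsonMeasure (d := d) (L := L) ρ β) (Θ := GaugeConfig.timeReflect)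
    (D := fun H : GaugeConfig d L G → ℝ => IsPositiveTimeObservable H)
    WilsonRP.measurable_timeReflect
    (FiniteSusceptibilityWeakCoupling.RPCauchySchwarz.wilsonMeasure_map_timeReflect ρ hρ β)
    FiniteSusceptibilityWeakCoupling.RPCauchySchwarz.timeReflect_timeReflect
    (fun H hH hHb hHD => integral_timeReflect_mul_nonneg_even ρ hL hρ hβ H hH hHb hHD)
    (fun H K t hH hK => isPositiveTimeObservable_add_mul hH hK t)
    (fun H c hH => isPositiveTimeObservable_sub_const hH c)
    (WilsonRP.measurable_plaqRe ρ hρ p) (WilsonRP.measurable_plaqRe ρ hρ p)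
    ⟨N, fun U => WilsonRP.abs_plaqRe_le ρ hρ U p⟩ ⟨N, fun U => WilsonRP.abs_plaqRe_le ρ hρ U p⟩
    (isPositiveTimeObservable_plaqRe_of_isPosPlaq ρ hp)
    (isPositiveTimeObservable_plaqRe_of_isPosPlaq ρ hp)
  obtain ⟨h0, -, -⟩ := key
  rw [covariance_plaqRe_eq ρ hρ β p p _ WilsonRP.measurable_timeReflect] at h0
  simpa only [WilsonRP.plaqRe_timeReflect ρ hρ] using h0

/-- **General site-mirror pairs** (`L` even, any `β`): for ANY site-positive or shared plaquette `p`
(spatial or temporal), `Cov(P_{ϑ'p}, P_p) ≥ 0` with `ϑ' = WilsonSiteRP.sitePlaqReflect`. [folklore] -/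
private theorem cov_sitePlaqReflect_nonneg (hL : Even L) (hρ : Continuous ρ) (β : ℝ)
    {p : Plaquette d L} (hp : WilsonSiteRP.IsSitePosPlaq p ∨ WilsonSiteRP.IsSharedPlaq p) :
    0 ≤ wilsonExpectation ρ β (fun U : GaugeConfig d L G =>
          WilsonRP.plaqRe ρ U (WilsonSiteRP.sitePlaqReflect p) * WilsonRP.plaqRe ρ U p)
        - wilsonExpectation ρ β (fun U : GaugeConfig d L G =>
            WilsonRP.plaqRe ρ U (WilsonSiteRP.sitePlaqReflect p))
          * wilsonExpectation ρ β (fun U : GaugeConfig d L G => WilsonRP.plaqRe ρ U p) := by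
  haveI := isProbabilityMeasure_wilsonMeasure (d := d) (L := L) ρ hρ β
  haveI : Fact (1 < L) := ⟨by obtain ⟨r, hr⟩ := hL; have := NeZero.ne L; omega⟩
  have key := FiniteSusceptibilityWeakCoupling.RPCauchySchwarz.covariance_rp_cauchySchwarz
    (μ := wilsonMeasure (d := d) (L := L) ρ β) (Θ := GaugeConfig.negReflect)
    (D := fun H : GaugeConfig d L G → ℝ => DependsOn H
      ((WilsonSiteRP.sitePosEdges ∪ WilsonSiteRP.sharedEdges : Finset (Edge d L)) : Set (Edge d L)))
    WilsonSiteRP.measurable_negReflect (WilsonSiteRP.wilsonMeasure_map_negReflect ρ hL hρ β)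
    WilsonSiteRP.negReflect_negReflect_config
    (fun H hH hHb hHD => integral_negReflect_mul_nonneg ρ hL hρ β H hH hHb hHD)
    (fun H K t hH hK => FiniteSusceptibilityWeakCoupling.RPCauchySchwarz.dependsOn_add_mul hH hK t)
    (fun H c hH => FiniteSusceptibilityWeakCoupling.RPCauchySchwarz.dependsOn_sub_const hH c)
    (WilsonRP.measurable_plaqRe ρ hρ p) (WilsonRP.measurable_plaqRe ρ hρ p)
    ⟨N, fun U => WilsonRP.abs_plaqRe_le ρ hρ U p⟩ ⟨N, fun U => WilsonRP.abs_plaqRe_le ρ hρ U p⟩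
    (dependsOn_plaqRe_of_isSitePosPlaq ρ hL hp) (dependsOn_plaqRe_of_isSitePosPlaq ρ hL hp)
  obtain ⟨h0, -, -⟩ := key
  rw [covariance_plaqRe_eq ρ hρ β p p _ WilsonSiteRP.measurable_negReflect] at h0
  simpa only [WilsonSiteRP.plaqRe_negReflect ρ hρ] using h0

/-- **General odd-torus mirror pairs** (`L` odd, `L ≥ 3`, `β ≥ 0`): for ANY odd-positive or odd-shared
plaquette `p` (spatial or temporal), `Cov(P_{ϑp}, P_p) ≥ 0` with `ϑ = WilsonRP.plaqReflect`. [folklore] -/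
private theorem cov_plaqReflect_nonneg_odd (hL : Odd L) (hL3 : 3 ≤ L) (hρ : Continuous ρ) {β : ℝ}
    (hβ : 0 ≤ β) {p : Plaquette d L} (hp : WilsonOddRP.IsOPosPlaq p ∨ WilsonOddRP.IsOSharedPlaq p) :
    0 ≤ wilsonExpectation ρ β (fun U : GaugeConfig d L G =>
          WilsonRP.plaqRe ρ U (WilsonRP.plaqReflect p) * WilsonRP.plaqRe ρ U p)
        - wilsonExpectation ρ β (fun U : GaugeConfig d L G =>
            WilsonRP.plaqRe ρ U (WilsonRP.plaqReflect p))
          * wilsonExpectation ρ β (fun U : GaugeConfig d L G => WilsonRP.plaqRe ρ U p) := by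
  haveI := isProbabilityMeasure_wilsonMeasure (d := d) (L := L) ρ hρ β
  haveI : Fact (1 < L) := ⟨by omega⟩
  have key := FiniteSusceptibilityWeakCoupling.RPCauchySchwarz.covariance_rp_cauchySchwarz
    (μ := wilsonMeasure (d := d) (L := L) ρ β) (Θ := GaugeConfig.timeReflect)
    (D := fun H : GaugeConfig d L G → ℝ => DependsOn H
      ((WilsonOddRP.oPosEdges ∪ WilsonOddRP.oSharedEdges : Finset (Edge d L)) : Set (Edge d L)))
    WilsonRP.measurable_timeReflect
    (FiniteSusceptibilityWeakCoupling.RPCauchySchwarz.wilsonMeasure_map_timeReflect ρ hρ β)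
    FiniteSusceptibilityWeakCoupling.RPCauchySchwarz.timeReflect_timeReflect
    (fun H hH hHb hHD => integral_timeReflect_mul_nonneg_odd ρ hL hL3 hρ hβ H hH hHb hHD)
    (fun H K t hH hK => FiniteSusceptibilityWeakCoupling.RPCauchySchwarz.dependsOn_add_mul hH hK t)
    (fun H c hH => FiniteSusceptibilityWeakCoupling.RPCauchySchwarz.dependsOn_sub_const hH c)
    (WilsonRP.measurable_plaqRe ρ hρ p) (WilsonRP.measurable_plaqRe ρ hρ p)
    ⟨N, fun U => WilsonRP.abs_plaqRe_le ρ hρ U p⟩ ⟨N, fun U => WilsonRP.abs_plaqRe_le ρ hρ U p⟩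
    (dependsOn_plaqRe_of_isOPosPlaq ρ hL hp) (dependsOn_plaqRe_of_isOPosPlaq ρ hL hp)
  obtain ⟨h0, -, -⟩ := key
  rw [covariance_plaqRe_eq ρ hρ β p p _ WilsonRP.measurable_timeReflect] at h0
  simpa only [WilsonRP.plaqRe_timeReflect ρ hρ] using h0

end TemporalMirror

/-! ## The longitudinal covariance on the time axis, then in the crux's coordinates -/

section LongAxis

variable {L N : ℕ} [NeZero L] {G : Type*} [Group G] [TopologicalSpace G]
  [IsTopologicalGroup G] [CompactSpace G] [MeasurableSpace G] [BorelSpace G]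
  (ρ : G →* Matrix (Fin N) (Fin N) ℂ)

/-- **Longitudinal time-axis form.** For every compact `G`, continuous `ρ`, `β ≥ 0`, every TEMPORAL
plane `q` (`q.1 = 0`) and every `n`: `Cov(P_0^{q}, P_{n e₀}^{q}) ≥ 0` on the torus `(ℤ/L)^{d+1}`.
Cases: `n ≡ 0` variance; `L` even: link (even `n`) / site (odd `n`) mirror pairs of temporal
plaquettes; `L` odd: odd-torus mirror pairs at separation `n` (even `n`) or `L − n` (odd `n`, swapped),
translated back to the origin. [folklore] -/
private theorem longTimeAxisCov_nonneg {d : ℕ} (hρ : Continuous ρ) {β : ℝ} (hβ : 0 ≤ β)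
    (q : {p : Fin (d + 1) × Fin (d + 1) // p.1 < p.2}) (hq : q.1.1 = 0) (n : ℕ) :
    0 ≤ wilsonExpectation ρ β (fun U : GaugeConfig (d + 1) L G =>
        WilsonRP.plaqRe ρ U ((0 : Site (d + 1) L), q) *
          WilsonRP.plaqRe ρ U ((Pi.single (0 : Fin (d + 1)) ((n : ℕ) : ZMod L) : Site (d + 1) L), q))
      - wilsonExpectation ρ β (fun U : GaugeConfig (d + 1) L G =>
          WilsonRP.plaqRe ρ U ((0 : Site (d + 1) L), q))
        * wilsonExpectation ρ β (fun U : GaugeConfig (d + 1) L G =>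
          WilsonRP.plaqRe ρ U ((Pi.single (0 : Fin (d + 1)) ((n : ℕ) : ZMod L) : Site (d + 1) L), q)) := by
  have hL0 : 0 < L := Nat.pos_of_ne_zero (NeZero.ne L)
  -- reduce to `n < L`
  rw [← ZMod.natCast_mod n L]
  set n' := n % L with hn'
  have hn'L : n' < L := Nat.mod_lt n hL0
  clear_value n'
  clear hn' n
  rcases Nat.eq_zero_or_pos n' with rfl | hn1
  · -- variance
    simp only [Nat.cast_zero, Pi.single_zero]
    exact var_plaqRe_nonneg ρ hρ β _
  -- from a time-axis pair `(c e₀, c' e₀)` with `c' - c = ± n'` to the pair `(0, n' e₀)`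
  have finish : ∀ (c c' : ZMod L), (c' - c = ((n' : ℕ) : ZMod L) ∨ c' - c = -((n' : ℕ) : ZMod L)) →
      0 ≤ wilsonExpectation ρ β (fun U : GaugeConfig (d + 1) L G =>
          WilsonRP.plaqRe ρ U ((Pi.single (0 : Fin (d + 1)) c : Site (d + 1) L), q) *
            WilsonRP.plaqRe ρ U ((Pi.single (0 : Fin (d + 1)) c' : Site (d + 1) L), q))
        - wilsonExpectation ρ β (fun U : GaugeConfig (d + 1) L G =>
            WilsonRP.plaqRe ρ U ((Pi.single (0 : Fin (d + 1)) c : Site (d + 1) L), q))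
          * wilsonExpectation ρ β (fun U : GaugeConfig (d + 1) L G =>
            WilsonRP.plaqRe ρ U ((Pi.single (0 : Fin (d + 1)) c' : Site (d + 1) L), q)) →
      0 ≤ wilsonExpectation ρ β (fun U : GaugeConfig (d + 1) L G =>
          WilsonRP.plaqRe ρ U ((0 : Site (d + 1) L), q) *
            WilsonRP.plaqRe ρ U ((Pi.single (0 : Fin (d + 1)) ((n' : ℕ) : ZMod L) : Site (d + 1) L), q))
        - wilsonExpectation ρ β (fun U : GaugeConfig (d + 1) L G =>
            WilsonRP.plaqRe ρ U ((0 : Site (d + 1) L), q))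
          * wilsonExpectation ρ β (fun U : GaugeConfig (d + 1) L G =>
            WilsonRP.plaqRe ρ U ((Pi.single (0 : Fin (d + 1)) ((n' : ℕ) : ZMod L) : Site (d + 1) L), q)) := by
    intro c c' hcc h
    have e := cov_pair_eq_origin ρ β (a := (Pi.single (0 : Fin (d + 1)) c : Site (d + 1) L))
      (b := (Pi.single (0 : Fin (d + 1)) c' : Site (d + 1) L))
      (x := (Pi.single (0 : Fin (d + 1)) ((n' : ℕ) : ZMod L) : Site (d + 1) L)) q (by
        rcases hcc with hcc | hcc
        · left; rw [← Pi.single_sub, hcc]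
        · right; rw [← Pi.single_sub, hcc, Pi.single_neg])
    rw [e] at h
    exact h
  rcases Nat.even_or_odd L with hL | hL
  · -- even torus
    rcases Nat.even_or_odd n' with hn | hn
    · -- even separation `n' = 2a`: link mirror of the temporal plaquette based at time `a`
      obtain ⟨a, rfl⟩ := hn
      obtain ⟨r, hr⟩ := hL
      have haL : a < L := by omega
      have hpos : WilsonRP.IsPosPlaq
          ((((Pi.single (0 : Fin (d + 1)) ((a : ℕ) : ZMod L) : Site (d + 1) L), q) :
            Plaquette (d + 1) L)) := by
        simp only [WilsonRP.IsPosPlaq, hq, ↓reduceIte, val_single_zero haL]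
        omega
      have h := cov_plaqReflect_nonneg_even ρ ⟨r, hr⟩ hρ hβ hpos
      rw [plaqReflect_single_of_eq_zero _ q hq] at h
      refine finish _ _ (Or.inl ?_) h
      push_cast
      ring
    · -- odd separation `n' = 2a + 1`: site mirror of the temporal plaquette based at time `a`
      obtain ⟨a, rfl⟩ := hn
      obtain ⟨r, hr⟩ := hL
      have haL : a < L := by omega
      have hpos : WilsonSiteRP.IsSitePosPlaq
          ((((Pi.single (0 : Fin (d + 1)) ((a : ℕ) : ZMod L) : Site (d + 1) L), q) :
            Plaquette (d + 1) L)) := by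
        simp only [WilsonSiteRP.IsSitePosPlaq, hq, ↓reduceIte, val_single_zero haL]
        omega
      have h := cov_sitePlaqReflect_nonneg ρ ⟨r, hr⟩ hρ β (Or.inl hpos)
      rw [sitePlaqReflect_single_of_eq_zero _ q hq] at h
      refine finish _ _ (Or.inl ?_) h
      push_cast
      ring
  · -- odd torus, `L = 2r + 1 ≥ 3`
    obtain ⟨r, hr⟩ := hL
    have hL3 : 3 ≤ L := by omega
    have hL' : ((2 * r + 1 : ℕ) : ZMod L) = 0 := by rw [← hr]; exact ZMod.natCast_self L
    rcases Nat.even_or_odd n' with hn | hn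
    · -- even separation `n' = 2a`: odd-torus mirror of the temporal plaquette based at time `a`
      obtain ⟨a, rfl⟩ := hn
      have haL : a < L := by omega
      have hpos : WilsonOddRP.IsOPosPlaq
          ((((Pi.single (0 : Fin (d + 1)) ((a : ℕ) : ZMod L) : Site (d + 1) L), q) :
            Plaquette (d + 1) L)) := by
        simp only [WilsonOddRP.IsOPosPlaq, val_single_zero haL]
        omega
      have h := cov_plaqReflect_nonneg_odd ρ ⟨r, hr⟩ hL3 hρ hβ (Or.inl hpos)
      rw [plaqReflect_single_of_eq_zero _ q hq] at h
      refine finish _ _ (Or.inl ?_) h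
      push_cast
      ring
    · -- odd separation `n' = 2k + 1`: odd-torus mirror at separation `L − n' = 2(r − k)`, swapped
      obtain ⟨k, rfl⟩ := hn
      have hkr : k ≤ r := by omega
      have haL : r - k < L := by omega
      have hpos : WilsonOddRP.IsOPosPlaq
          ((((Pi.single (0 : Fin (d + 1)) (((r - k : ℕ) : ℕ) : ZMod L) : Site (d + 1) L), q) :
            Plaquette (d + 1) L)) := by
        simp only [WilsonOddRP.IsOPosPlaq, val_single_zero haL]
        omega
      have h := cov_plaqReflect_nonneg_odd ρ ⟨r, hr⟩ hL3 hρ hβ (Or.inl hpos)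
      rw [plaqReflect_single_of_eq_zero _ q hq, cov_symm] at h
      refine finish _ _ (Or.inl ?_) h
      push_cast [Nat.cast_sub hkr] at hL' ⊢
      linear_combination (-1 : ZMod L) * hL'

/-- **The crux's longitudinal pair in `plaqRe` coordinates** (`Cov(N − A, N − B) = Cov(A, B)`, tree
`AxisCovNonneg.cov_const_sub`; `WilsonRP.plaqRe ρ U (x, (0,1))` is definitionally `Re tr ρ(U_{x;0,1})`):
`Cov_{L,β}(P_0^{01}, P_{s e₀}^{01}) = Cov_{L,β}(Re tr ρ(U_{p(0;0,1)}), Re tr ρ(U_{p(s e₀;0,1)}))`. [folklore] -/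
private theorem cruxLongCov_eq (hρ : Continuous ρ) (β : ℝ) (s : ℕ) :
    wilsonExpectation ρ β (fun U : GaugeConfig 4 L G =>
          ((N : ℝ) - (ρ (plaquetteHolonomy U 0 0 1)).trace.re) *
            ((N : ℝ) - (ρ (plaquetteHolonomy U
              (Pi.single (0 : Fin 4) ((s : ℕ) : ZMod L)) 0 1)).trace.re))
        - wilsonExpectation ρ β (fun U : GaugeConfig 4 L G =>
            (N : ℝ) - (ρ (plaquetteHolonomy U 0 0 1)).trace.re)
          * wilsonExpectation ρ β (fun U : GaugeConfig 4 L G =>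
            (N : ℝ) - (ρ (plaquetteHolonomy U
              (Pi.single (0 : Fin 4) ((s : ℕ) : ZMod L)) 0 1)).trace.re) =
    wilsonExpectation ρ β (fun U : GaugeConfig 4 L G =>
        WilsonRP.plaqRe ρ U ((0 : Site 4 L), ⟨((0 : Fin 4), (1 : Fin 4)), by decide⟩) *
          WilsonRP.plaqRe ρ U ((Pi.single (0 : Fin 4) ((s : ℕ) : ZMod L) : Site 4 L),
            ⟨((0 : Fin 4), (1 : Fin 4)), by decide⟩))
      - wilsonExpectation ρ β (fun U : GaugeConfig 4 L G =>
          WilsonRP.plaqRe ρ U ((0 : Site 4 L), ⟨((0 : Fin 4), (1 : Fin 4)), by decide⟩))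
        * wilsonExpectation ρ β (fun U : GaugeConfig 4 L G =>
          WilsonRP.plaqRe ρ U ((Pi.single (0 : Fin 4) ((s : ℕ) : ZMod L) : Site 4 L),
            ⟨((0 : Fin 4), (1 : Fin 4)), by decide⟩)) := by
  haveI := isProbabilityMeasure_wilsonMeasure (d := 4) (L := L) ρ hρ β
  set q01 : {p : Fin 4 × Fin 4 // p.1 < p.2} := ⟨((0 : Fin 4), (1 : Fin 4)), by decide⟩ with hq01
  have hA : ∀ U : GaugeConfig 4 L G, (ρ (plaquetteHolonomy U 0 0 1)).trace.re =
      WilsonRP.plaqRe ρ U ((0 : Site 4 L), q01) := fun U => rfl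
  have hB : ∀ U : GaugeConfig 4 L G,
      (ρ (plaquetteHolonomy U (Pi.single (0 : Fin 4) ((s : ℕ) : ZMod L)) 0 1)).trace.re =
        WilsonRP.plaqRe ρ U ((Pi.single (0 : Fin 4) ((s : ℕ) : ZMod L) : Site 4 L), q01) :=
    fun U => rfl
  simp only [hA, hB]
  have hmA := WilsonRP.measurable_plaqRe ρ hρ (((0 : Site 4 L), q01) : Plaquette 4 L)
  have hmB := WilsonRP.measurable_plaqRe ρ hρ
    (((Pi.single (0 : Fin 4) ((s : ℕ) : ZMod L) : Site 4 L), q01) : Plaquette 4 L)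
  have step1 := cov_const_sub (wilsonMeasure (d := 4) (L := L) ρ β) hmA hmB
    ⟨N, fun U => WilsonRP.abs_plaqRe_le ρ hρ U _⟩ ⟨N, fun U => WilsonRP.abs_plaqRe_le ρ hρ U _⟩ (N : ℝ)
  simp only [wilsonExpectation] at step1 ⊢
  rw [step1]

/-- **The crux's longitudinal profile is non-negative and symmetric** (`plaquetteHolonomy` coordinates on
`(ℤ/L)⁴`): `0 ≤ g(s)` for every `s` and `g(L − s) = g(s)` for `s ≤ L`, where
`g(s) = Cov_{L,β}(P_0^{01}, P_{s e₀}^{01})`, `P = N − Re tr ρ(U_p)`. [folklore] -/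
theorem longPlaquetteCov_nonneg_symm (hρ : Continuous ρ) {β : ℝ} (hβ : 0 ≤ β) :
    (∀ s : ℕ, 0 ≤ wilsonExpectation ρ β (fun U : GaugeConfig 4 L G =>
          ((N : ℝ) - (ρ (plaquetteHolonomy U 0 0 1)).trace.re) *
            ((N : ℝ) - (ρ (plaquetteHolonomy U
              (Pi.single (0 : Fin 4) ((s : ℕ) : ZMod L)) 0 1)).trace.re))
        - wilsonExpectation ρ β (fun U : GaugeConfig 4 L G =>
            (N : ℝ) - (ρ (plaquetteHolonomy U 0 0 1)).trace.re)
          * wilsonExpectation ρ β (fun U : GaugeConfig 4 L G =>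
            (N : ℝ) - (ρ (plaquetteHolonomy U
              (Pi.single (0 : Fin 4) ((s : ℕ) : ZMod L)) 0 1)).trace.re)) ∧
    (∀ s : ℕ, s ≤ L →
      wilsonExpectation ρ β (fun U : GaugeConfig 4 L G =>
          ((N : ℝ) - (ρ (plaquetteHolonomy U 0 0 1)).trace.re) *
            ((N : ℝ) - (ρ (plaquetteHolonomy U
              (Pi.single (0 : Fin 4) (((L - s : ℕ) : ℕ) : ZMod L)) 0 1)).trace.re))
        - wilsonExpectation ρ β (fun U : GaugeConfig 4 L G =>
            (N : ℝ) - (ρ (plaquetteHolonomy U 0 0 1)).trace.re)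
          * wilsonExpectation ρ β (fun U : GaugeConfig 4 L G =>
            (N : ℝ) - (ρ (plaquetteHolonomy U
              (Pi.single (0 : Fin 4) (((L - s : ℕ) : ℕ) : ZMod L)) 0 1)).trace.re) =
      wilsonExpectation ρ β (fun U : GaugeConfig 4 L G =>
          ((N : ℝ) - (ρ (plaquetteHolonomy U 0 0 1)).trace.re) *
            ((N : ℝ) - (ρ (plaquetteHolonomy U
              (Pi.single (0 : Fin 4) ((s : ℕ) : ZMod L)) 0 1)).trace.re))
        - wilsonExpectation ρ β (fun U : GaugeConfig 4 L G =>
            (N : ℝ) - (ρ (plaquetteHolonomy U 0 0 1)).trace.re)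
          * wilsonExpectation ρ β (fun U : GaugeConfig 4 L G =>
            (N : ℝ) - (ρ (plaquetteHolonomy U
              (Pi.single (0 : Fin 4) ((s : ℕ) : ZMod L)) 0 1)).trace.re)) := by
  refine ⟨fun s => ?_, fun s hs => ?_⟩
  · rw [cruxLongCov_eq ρ hρ β s]
    exact longTimeAxisCov_nonneg (L := L) (d := 3) ρ hρ hβ _ rfl s
  · rw [cruxLongCov_eq ρ hρ β (L - s), cruxLongCov_eq ρ hρ β s]
    have e : (((L - s : ℕ) : ℕ) : ZMod L) = -((s : ℕ) : ZMod L) := by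
      rw [Nat.cast_sub hs, ZMod.natCast_self, zero_sub]
    rw [e, Pi.single_neg]
    exact cov_origin_neg ρ β _ _

end LongAxis

end Summit.QuantumFields.YangMills.Theorems.FemtoCurvatureTwoPoint.AxisCovNonneg

namespace Summit.QuantumFields.YangMills.Theorems.FemtoCurvatureTwoPointC

/-- **Registered stub `stub_longCovNonnegSymm`** (line `Sketch`, skeleton v6, `--supports stmt-QuantumFields-16204`): the LONGITUDINAL plaquette-covariance profile is non-negative and symmetric (reflection positivity). For every compact `G`, continuous `ρ`, torus `(ℤ/L)⁴` and `β ≥ 0`, the longitudinal profile `g(s) = Cov_{L,β}(P_0^{01}, P_{s e₀}^{01})` (`P = N − Re tr ρ(U_p)`) satisfies `g ≥ 0` and `g(L − s) = g(s)`. [folklore] -/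
theorem stub_longCovNonnegSymm :
    ∀ (L N : ℕ) [NeZero L] (G : Type) [Group G] [TopologicalSpace G] [IsTopologicalGroup G] [CompactSpace G] [MeasurableSpace G] [BorelSpace G] (ρ : G →* Matrix (Fin N) (Fin N) ℂ), Continuous ρ → ∀ (β : ℝ), 0 ≤ β → ∀ (g : ℕ → ℝ), (g = fun s : ℕ => wilsonExpectation ρ β (fun U : GaugeConfig 4 L G => ((N : ℝ) - (ρ (plaquetteHolonomy U 0 0 1)).trace.re) * ((N : ℝ) - (ρ (plaquetteHolonomy U (Pi.single (0 : Fin 4) ((s : ℕ) : ZMod L)) 0 1)).trace.re)) - wilsonExpectation ρ β (fun U : GaugeConfig 4 L G => (N : ℝ) - (ρ (plaquetteHolonomy U 0 0 1)).trace.re) * wilsonExpectation ρ β (fun U : GaugeConfig 4 L G => (N : ℝ) - (ρ (plaquetteHolonomy U (Pi.single (0 : Fin 4) ((s : ℕ) : ZMod L)) 0 1)).trace.re)) → (∀ s : ℕ, 0 ≤ g s) ∧ (∀ s : ℕ, s ≤ L → g (L - s) = g s) := by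
  intro L N _ G _ _ _ _ _ _ ρ hρ β hβ g hg
  subst hg
  exact FemtoCurvatureTwoPoint.AxisCovNonneg.longPlaquetteCov_nonneg_symm ρ hρ hβ

end Summit.QuantumFields.YangMills.Theorems.FemtoCurvatureTwoPointC

end
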